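import Literature.AlgebraicGeometry.AbelianSchemes.SymplecticLiftReindex
import Literature.AlgebraicGeometry.ModuliOfAbelianVarieties.SiegelPrincipalLevelSimilitudeTower
import HarnessLib

/-!
# The re-indexing tower of `k ∈ K_δ(N) ≤ GSp_δ(ẑ)` and the adelic congruence under right `K_δ(N)`-translates

Topic `Literature/AlgebraicGeometry/ModuliOfAbelianVarieties`.  For `k ∈ K_δ(N)` (`N ≠ 0`) the COMPATIBLE TOWER
`κ_M := k mod M ∈ GL_{2g}(ℤ/M)` (entrywise ★ D6 `integralAdeleResidue M`), trivial at level `N`, with unit multipliers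
`u_M := ν(k) mod M` — the data ★ `AbelianSchemes/SymplecticLiftReindex` consumes ([Lan2013PELCompactifications] §1.3.6;
[Deligne1971TravauxShimura] 4.16; [Milne2005ShimuraVarieties] §6 p. 75 «`K(N)` acts as `1` on `V(ẑ)/NV(ẑ)`»):
`liftIntegralMatrix` (+ `_map_subtype`, `map_subtype_injective`) · **`exists_isMultiplier_mem_integralAdeles_of_mem_principalLevelSubgroup_one`**
(the multiplier of `k ∈ K_δ(1)` is an integral unit for EVERY type `δ` — Bézout on `E_δ / gcd δ`; the hypothesis-free companion of
★ `SiegelPrincipalLevelMultiplier.sub_one_mem_levelIdeal_of_isMultiplier_of_isPolarizationType`) ·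
**`reindexTowerOf (hN) (hk) : ReindexTower g N δ`** (similitude clause by ★ `SiegelPrincipalLevelSimilitudeTower.typeFormMod_mulVec_mulVec_of_transpose_mul_mul`),
`reindexTowerOf_κ_apply` · `eq_one_of_mem_principalLevelSubgroup_zero` · **`adelicCongr_inv_reindex_of_adelicCongr_mul_inv`**
(`(bk)⁻¹v̂ ≡ x/M ⇒ b⁻¹v̂ ≡ (κ_M x)/M`: ★ R60-58 `AdelicCongr.mul_left`/`.trans` + ★ `adelicCongr_val_div_of_entries_residue`).
Cell `hodgecm-mathlib`, M1′ W-layer leaf (T2), hoisted from the (P)-workfile § 6 (B-plan1 P39); banked generic leaf; HC_CM is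
proved only modulo the printed citations until rung 0 closes.

References: [Lan2013PELCompactifications] §1.3.6 (pp. 79–81) · [Deligne1971TravauxShimura] Exemple 4.16 p. 150 · [Milne2005ShimuraVarieties] (2017 rev.) §6 p. 67, Thm. 6.11 p. 74 and p. 75.
-/

set_option autoImplicit false

noncomputable section

namespace Literature.AlgebraicGeometry.ModuliOfAbelianVarieties

open Literature.NumberTheory.Adeles Literature.AlgebraicGeometry.AbelianSchemes
open IsDedekindDomain NumberField
open scoped Matrix

variable {g : ℕ}

/-- An integral adelic matrix as a matrix over the subring `ẑ`. [cite: Milne2005ShimuraVarieties, §6 p. 75] -/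
def liftIntegralMatrix (A : Matrix (Fin g ⊕ Fin g) (Fin g ⊕ Fin g) finAdeleQ)
    (hA : ∀ i j, A i j ∈ FiniteAdeleRing.integralAdeles (𝓞 ℚ) ℚ) :
    Matrix (Fin g ⊕ Fin g) (Fin g ⊕ Fin g) (FiniteAdeleRing.integralAdeles (𝓞 ℚ) ℚ) :=
  Matrix.of fun i j => ⟨A i j, hA i j⟩

/-- `liftIntegralMatrix A` maps back to `A` under the inclusion `ẑ ⊂ 𝔸_f`. [cite: Milne2005ShimuraVarieties, §6 p. 75] -/
theorem liftIntegralMatrix_map_subtype (A : Matrix (Fin g ⊕ Fin g) (Fin g ⊕ Fin g) finAdeleQ)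
    (hA : ∀ i j, A i j ∈ FiniteAdeleRing.integralAdeles (𝓞 ℚ) ℚ) :
    (liftIntegralMatrix A hA).map (FiniteAdeleRing.integralAdeles (𝓞 ℚ) ℚ).subtype = A := by
  ext i j; rfl

/-- The inclusion `M_{2g}(ẑ) → M_{2g}(𝔸_f)` is injective. [cite: Milne2005ShimuraVarieties, §6 p. 75] -/
theorem map_subtype_injective :
    Function.Injective fun B : Matrix (Fin g ⊕ Fin g) (Fin g ⊕ Fin g) (FiniteAdeleRing.integralAdeles (𝓞 ℚ) ℚ) =>
      B.map (FiniteAdeleRing.integralAdeles (𝓞 ℚ) ℚ).subtype :=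
  fun B B' h => Matrix.ext fun i j => Subtype.ext (by
    have := congrArg (fun C : Matrix (Fin g ⊕ Fin g) (Fin g ⊕ Fin g) finAdeleQ => C i j) h
    simpa [Matrix.map_apply] using this)

variable (δ : Fin g → ℕ)

/-- Bézout for `Finset.gcd` over `ℤ`: the gcd of a finite set of integers is an integer combination of its elements
(private copy of the folklore lemma of ★ `Combinatorics/Additive/LevSmeliansky`). [folklore] -/
private theorem exists_sum_mul_eq_gcd' (A : Finset ℤ) : ∃ f : ℤ → ℤ, ∑ a ∈ A, f a * a = A.gcd id := by
  classical
  induction A using Finset.induction_on with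
  | empty => exact ⟨fun _ => 0, by simp⟩
  | insert b s hb ih =>
    obtain ⟨f, hf⟩ := ih
    set G := s.gcd id with hG
    refine ⟨fun a => if a = b then Int.gcdA b G else Int.gcdB b G * f a, ?_⟩
    have hrest : ∑ a ∈ s, (if a = b then Int.gcdA b G else Int.gcdB b G * f a) * a
        = Int.gcdB b G * ∑ a ∈ s, f a * a := by
      rw [Finset.mul_sum]
      refine Finset.sum_congr rfl fun a ha => ?_
      rw [if_neg (show a ≠ b from fun h => hb (h ▸ ha))]; ring
    rw [Finset.sum_insert hb, Finset.gcd_insert]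
    dsimp only [id]
    rw [if_pos rfl, hrest, hf, ← Int.coe_gcd, Int.gcd_eq_gcd_ab]
    ring

/-- **The multiplier of an element of `K_δ(1) = GSp_δ(ẑ)` is an integral unit**: for `k ∈ K_δ(1)` there is a multiplier
`ν` (`kᵀE_δk = νE_δ`) with `ν, ν⁻¹ ∈ ẑ`.  If `E_δ = 0` take `ν = 1`; otherwise write `δᵢ = d·eᵢ` with `gcd(eᵢ) = 1`
(`Finset.extract_gcd`): `k` is a similitude of the INTEGRAL form `d⁻¹E_δ` with the same `ν`, whose `(i, g+i)` entries are the
`eᵢ`, so `ν·eᵢ ∈ ẑ` for all `i` and Bézout gives `ν ∈ ẑ`; the same for `k⁻¹`, `ν⁻¹`.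
[cite: Milne2005ShimuraVarieties, §6 p. 67 and p. 75] [cite: Deligne1971TravauxShimura, Exemple 4.16 p. 150] -/
theorem exists_isMultiplier_mem_integralAdeles_of_mem_principalLevelSubgroup_one {k : gspFinAdelic δ}
    (hk : k ∈ principalLevelSubgroup δ 1) :
    ∃ ν : finAdeleQˣ, IsMultiplier (typeFormOver δ finAdeleQ) (k : GL (Fin g ⊕ Fin g) finAdeleQ) ν ∧
      (ν : finAdeleQ) ∈ FiniteAdeleRing.integralAdeles (𝓞 ℚ) ℚ ∧
      ((ν⁻¹ : finAdeleQˣ) : finAdeleQ) ∈ FiniteAdeleRing.integralAdeles (𝓞 ℚ) ℚ := by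
  classical
  obtain ⟨ν, hν⟩ := k.2
  have hk1 := isIntegral_of_isCongOne_one hk.1
  have hk2 := isIntegral_of_isCongOne_one hk.2
  -- the gcd `d` of the `δᵢ` and the decomposition `δᵢ = d eᵢ`, `gcd e = 1`
  by_cases hg : (Finset.univ : Finset (Fin g)).Nonempty
  swap
  · -- `g = 0`: every matrix is empty, `ν := 1`
    refine ⟨1, ?_, one_mem _, by rw [inv_one]; exact one_mem _⟩
    rw [isMultiplier_iff]
    ext i j
    exact absurd ⟨i.elim id id, Finset.mem_univ _⟩ hg
  obtain ⟨e, he, hge⟩ := Finset.extract_gcd (f := fun i : Fin g => (δ i : ℤ)) hg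
  set d : ℤ := (Finset.univ : Finset (Fin g)).gcd (fun i : Fin g => (δ i : ℤ)) with hd
  by_cases hd0 : d = 0
  · -- `E_δ = 0`: `ν := 1`
    have hδ0 : ∀ i, δ i = 0 := fun i => by
      have := he i (Finset.mem_univ i)
      rw [hd0, zero_mul] at this
      exact_mod_cast this
    have hE : typeFormOver δ finAdeleQ = 0 := by
      ext a b
      rw [typeFormOver_apply, typeForm, Matrix.zero_apply]
      rcases a with a | a <;> rcases b with b | b <;>
        simp [Matrix.fromBlocks_apply₁₁, Matrix.fromBlocks_apply₁₂, Matrix.fromBlocks_apply₂₁,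
          Matrix.fromBlocks_apply₂₂, hδ0]
    refine ⟨1, ?_, one_mem _, by rw [inv_one]; exact one_mem _⟩
    rw [isMultiplier_iff, hE, Matrix.mul_zero, Matrix.zero_mul, smul_zero]
  -- `d ≠ 0`: the integral form `E' := d⁻¹ E_δ`
  have hdQ : (d : ℚ) ≠ 0 := Int.cast_ne_zero.2 hd0
  let dA : finAdeleQˣ := Units.map (algebraMap ℚ finAdeleQ : ℚ →* finAdeleQ) (Units.mk0 (d : ℚ) hdQ)
  have hdA : (dA : finAdeleQ) = (d : finAdeleQ) := by
    change algebraMap ℚ finAdeleQ (d : ℚ) = _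
    rw [map_intCast]
  let E' : Matrix (Fin g ⊕ Fin g) (Fin g ⊕ Fin g) finAdeleQ := ((dA⁻¹ : finAdeleQˣ) : finAdeleQ) • typeFormOver δ finAdeleQ
  -- entries of `E'`: `0` and `± eᵢ`, all integral
  have hdiag : ∀ i, ((dA⁻¹ : finAdeleQˣ) : finAdeleQ) * (δ i : finAdeleQ) = (e i : finAdeleQ) := by
    intro i
    have := he i (Finset.mem_univ i)
    have h' : (δ i : finAdeleQ) = (d : finAdeleQ) * (e i : finAdeleQ) := by exact_mod_cast congrArg (fun z : ℤ => (z : finAdeleQ)) this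
    rw [h', ← hdA, Units.inv_mul_cancel_left]
  have hE'int : ∀ a b, E' a b ∈ FiniteAdeleRing.integralAdeles (𝓞 ℚ) ℚ := by
    rintro (a | a) (b | b)
    · simp only [E', Matrix.smul_apply, typeFormOver_apply, typeForm, Matrix.fromBlocks_apply₁₁, Matrix.zero_apply,
        Int.cast_zero, smul_zero]; exact zero_mem _
    · simp only [E', Matrix.smul_apply, typeFormOver_apply, typeForm, Matrix.fromBlocks_apply₁₂, Matrix.diagonal_apply,
        smul_eq_mul]
      by_cases hab : a = b
      · rw [if_pos hab, Int.cast_natCast, hdiag]; exact intCast_mem_integralAdeles _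
      · rw [if_neg hab, Int.cast_zero, mul_zero]; exact zero_mem _
    · simp only [E', Matrix.smul_apply, typeFormOver_apply, typeForm, Matrix.fromBlocks_apply₂₁, Matrix.neg_apply,
        Matrix.diagonal_apply, smul_eq_mul]
      by_cases hab : a = b
      · rw [if_pos hab, Int.cast_neg, Int.cast_natCast, mul_neg, hdiag]; exact neg_mem (intCast_mem_integralAdeles _)
      · rw [if_neg hab, neg_zero, Int.cast_zero, mul_zero]; exact zero_mem _
    · simp only [E', Matrix.smul_apply, typeFormOver_apply, typeForm, Matrix.fromBlocks_apply₂₂, Matrix.zero_apply,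
        Int.cast_zero, smul_zero]; exact zero_mem _
  have hE'diag : ∀ i, E' (Sum.inl i) (Sum.inr i) = (e i : finAdeleQ) := fun i => by
    simp only [E', Matrix.smul_apply, typeFormOver_apply, typeForm, Matrix.fromBlocks_apply₁₂, Matrix.diagonal_apply_eq,
      Int.cast_natCast, smul_eq_mul, hdiag]
  -- `k`, `k⁻¹` are `E'`-similitudes with multipliers `ν`, `ν⁻¹`
  have hsim : ∀ (G : GL (Fin g ⊕ Fin g) finAdeleQ) (μ : finAdeleQˣ), IsMultiplier (typeFormOver δ finAdeleQ) G μ →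
      (G : Matrix (Fin g ⊕ Fin g) (Fin g ⊕ Fin g) finAdeleQ)ᵀ * E' * (G : Matrix (Fin g ⊕ Fin g) (Fin g ⊕ Fin g) finAdeleQ) = (μ : finAdeleQ) • E' := by
    intro G μ h
    rw [isMultiplier_iff] at h
    simp only [E', Matrix.mul_smul, Matrix.smul_mul, h, smul_comm (μ : finAdeleQ)]
  -- Bézout on the `eᵢ`
  obtain ⟨f, hf⟩ := exists_sum_mul_eq_gcd' ((Finset.univ : Finset (Fin g)).image e)
  rw [Finset.gcd_image] at hf
  have hge' : (Finset.univ : Finset (Fin g)).gcd (id ∘ e) = 1 := hge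
  rw [hge'] at hf
  -- integrality of a multiplier `μ` of an integral `E'`-similitude `G`
  have key : ∀ (G : GL (Fin g ⊕ Fin g) finAdeleQ) (μ : finAdeleQˣ),
      (∀ i j, (G : Matrix (Fin g ⊕ Fin g) (Fin g ⊕ Fin g) finAdeleQ) i j ∈ FiniteAdeleRing.integralAdeles (𝓞 ℚ) ℚ) →
      (G : Matrix (Fin g ⊕ Fin g) (Fin g ⊕ Fin g) finAdeleQ)ᵀ * E' * (G : Matrix (Fin g ⊕ Fin g) (Fin g ⊕ Fin g) finAdeleQ) = (μ : finAdeleQ) • E' →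
      (μ : finAdeleQ) ∈ FiniteAdeleRing.integralAdeles (𝓞 ℚ) ℚ := by
    intro G μ hG hGE
    -- `μ eᵢ` is an entry of an integral matrix
    have hμe : ∀ i, (μ : finAdeleQ) * (e i : finAdeleQ) ∈ FiniteAdeleRing.integralAdeles (𝓞 ℚ) ℚ := by
      intro i
      have h1 : ((μ : finAdeleQ) • E') (Sum.inl i) (Sum.inr i) = (μ : finAdeleQ) * (e i : finAdeleQ) := by
        rw [Matrix.smul_apply, hE'diag, smul_eq_mul]
      rw [← h1, ← hGE]
      have hprod : (G : Matrix (Fin g ⊕ Fin g) (Fin g ⊕ Fin g) finAdeleQ)ᵀ * E' * (G : Matrix (Fin g ⊕ Fin g) (Fin g ⊕ Fin g) finAdeleQ) ∈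
          (FiniteAdeleRing.integralAdeles (𝓞 ℚ) ℚ).matrix := by
        refine Subring.mul_mem _ (Subring.mul_mem _ ?_ ?_) ?_
        · exact fun i j => by rw [Matrix.transpose_apply]; exact hG j i
        · exact hE'int
        · exact hG
      exact hprod _ _
    have hsum : (μ : finAdeleQ) = ∑ a ∈ (Finset.univ : Finset (Fin g)).image e, (f a : finAdeleQ) * ((μ : finAdeleQ) * (a : finAdeleQ)) :=
      calc (μ : finAdeleQ) = (μ : finAdeleQ) * ((∑ a ∈ (Finset.univ : Finset (Fin g)).image e, f a * a : ℤ) : finAdeleQ) := by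
            rw [hf, Int.cast_one, mul_one]
        _ = ∑ a ∈ (Finset.univ : Finset (Fin g)).image e, (f a : finAdeleQ) * ((μ : finAdeleQ) * (a : finAdeleQ)) := by
            rw [Int.cast_sum, Finset.mul_sum]
            refine Finset.sum_congr rfl fun a _ => ?_
            push_cast
            ring
    rw [hsum]
    refine sum_mem fun a ha => mul_mem (intCast_mem_integralAdeles _) ?_
    obtain ⟨i, -, rfl⟩ := Finset.mem_image.1 ha
    exact hμe i
  refine ⟨ν, hν, key _ ν hk1 (hsim _ ν hν), key _ ν⁻¹ hk2 ?_⟩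
  have := hsim _ ν⁻¹ hν.inv
  simpa only [Units.val_inv_eq_inv_val] using this

variable {δ}

section Tower

variable {N : ℕ} {k : gspFinAdelic δ}

/-- **The re-indexing tower of `k ∈ K_δ(N)`** (`N ≠ 0`): `κ_M := k mod M`, `κinv_M := k⁻¹ mod M` (entrywise ★
`integralAdeleResidue M` on the integral matrices `k, k⁻¹ ∈ GSp_δ(ẑ)`), `u_M := ν(k) mod M` for the integral unit multiplier
`ν(k)` (★ `exists_isMultiplier_mem_integralAdeles_of_mem_principalLevelSubgroup_one`); at `M = 0` (never used) junk `1`.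
[cite: Deligne1971TravauxShimura, Exemple 4.16 p. 150] [cite: Lan2013PELCompactifications, §1.3.6 Def. 1.3.6.2 (p. 80)] -/
def reindexTowerOf (hN : N ≠ 0) (hk : k ∈ principalLevelSubgroup δ N) : AbelianSchemeOver.ReindexTower g N δ := by
  classical
  have hk1 : k ∈ principalLevelSubgroup δ 1 := principalLevelSubgroup_anti δ (one_dvd N) hk
  have hν := exists_isMultiplier_mem_integralAdeles_of_mem_principalLevelSubgroup_one δ hk1
  have hkint := isIntegral_of_isCongOne_one hk1.1
  have hkint' : ∀ i j, ((((k : GL (Fin g ⊕ Fin g) finAdeleQ)⁻¹ : GL (Fin g ⊕ Fin g) finAdeleQ) :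
      Matrix (Fin g ⊕ Fin g) (Fin g ⊕ Fin g) finAdeleQ) i j) ∈ FiniteAdeleRing.integralAdeles (𝓞 ℚ) ℚ := by
    simpa only [Subgroup.coe_inv] using isIntegral_of_isCongOne_one hk1.2
  let Kz := liftIntegralMatrix ((k : GL (Fin g ⊕ Fin g) finAdeleQ) : Matrix (Fin g ⊕ Fin g) (Fin g ⊕ Fin g) finAdeleQ) hkint
  let Kzi := liftIntegralMatrix (((k : GL (Fin g ⊕ Fin g) finAdeleQ)⁻¹ : GL (Fin g ⊕ Fin g) finAdeleQ) :
    Matrix (Fin g ⊕ Fin g) (Fin g ⊕ Fin g) finAdeleQ) hkint'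
  let νz : FiniteAdeleRing.integralAdeles (𝓞 ℚ) ℚ := ⟨hν.choose, hν.choose_spec.2.1⟩
  let νzi : FiniteAdeleRing.integralAdeles (𝓞 ℚ) ℚ := ⟨((hν.choose⁻¹ : finAdeleQˣ) : finAdeleQ), hν.choose_spec.2.2⟩
  let Ez : Matrix (Fin g ⊕ Fin g) (Fin g ⊕ Fin g) (FiniteAdeleRing.integralAdeles (𝓞 ℚ) ℚ) := typeFormOver δ _
  -- the four identities over `ẑ`, read off their images in `𝔸_f`
  have one_map : (1 : Matrix (Fin g ⊕ Fin g) (Fin g ⊕ Fin g) (FiniteAdeleRing.integralAdeles (𝓞 ℚ) ℚ)).map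
      (FiniteAdeleRing.integralAdeles (𝓞 ℚ) ℚ).subtype = 1 := Matrix.map_one _ (map_zero _) (map_one _)
  have hKK : Kz * Kzi = 1 := map_subtype_injective (by
    change (Kz * Kzi).map _ = (1 : Matrix _ _ _).map _
    rw [Matrix.map_mul, liftIntegralMatrix_map_subtype, liftIntegralMatrix_map_subtype, one_map, ← Units.val_mul,
      mul_inv_cancel, Units.val_one])
  have hKK' : Kzi * Kz = 1 := map_subtype_injective (by
    change (Kzi * Kz).map _ = (1 : Matrix _ _ _).map _
    rw [Matrix.map_mul, liftIntegralMatrix_map_subtype, liftIntegralMatrix_map_subtype, one_map, ← Units.val_mul,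
      inv_mul_cancel, Units.val_one])
  have hEz : Ez.map (FiniteAdeleRing.integralAdeles (𝓞 ℚ) ℚ).subtype = typeFormOver δ finAdeleQ :=
    typeFormOver_map δ _
  have hKE : Kzᵀ * Ez * Kz = νz • Ez := map_subtype_injective (by
    change (Kzᵀ * Ez * Kz).map _ = (νz • Ez).map _
    rw [Matrix.map_mul, Matrix.map_mul, Matrix.transpose_map, liftIntegralMatrix_map_subtype, hEz,
      Matrix.map_smul' _ _ _ (map_mul _), hEz]
    exact hν.choose_spec.1)
  have hνν : νz * νzi = 1 := Subtype.ext (by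
    change (hν.choose : finAdeleQ) * ((hν.choose⁻¹ : finAdeleQˣ) : finAdeleQ) = 1
    rw [← Units.val_mul, mul_inv_cancel, Units.val_one])
  exact
  { κ := fun M => if h : M = 0 then 1 else haveI : NeZero M := ⟨h⟩; Kz.map (integralAdeleResidue M)
    κinv := fun M => if h : M = 0 then 1 else haveI : NeZero M := ⟨h⟩; Kzi.map (integralAdeleResidue M)
    u := fun M => if h : M = 0 then 1 else haveI : NeZero M := ⟨h⟩; integralAdeleResidue M νz
    κ_mul_κinv := fun M hM hM₀ => by
      haveI : NeZero M := ⟨hM₀⟩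
      simp only [dif_neg hM₀]
      rw [← Matrix.map_mul, hKK, Matrix.map_one _ (map_zero _) (map_one _)]
    κinv_mul_κ := fun M hM hM₀ => by
      haveI : NeZero M := ⟨hM₀⟩
      simp only [dif_neg hM₀]
      rw [← Matrix.map_mul, hKK', Matrix.map_one _ (map_zero _) (map_one _)]
    κ_compat := fun M k' hM hM₀ hk' => by
      haveI : NeZero M := ⟨hM₀⟩
      haveI : NeZero (k' * M) := ⟨mul_ne_zero hk' hM₀⟩
      simp only [dif_neg hM₀, dif_neg (mul_ne_zero hk' hM₀)]
      rw [Matrix.map_map, ← RingHom.coe_comp, castHom_comp_integralAdeleResidue]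
    κ_level := by
      haveI : NeZero N := ⟨hN⟩
      simp only [dif_neg hN]
      ext i j
      rw [Matrix.map_apply]
      exact (mem_principalLevelSubgroup_iff_forall_integralAdeleResidue_eq N δ hk1).1 hk i j
    isUnit_u := fun M hM hM₀ => by
      haveI : NeZero M := ⟨hM₀⟩
      simp only [dif_neg hM₀]
      exact isUnit_iff_exists_inv.2 ⟨integralAdeleResidue M νzi, by rw [← map_mul, hνν, map_one]⟩
    u_compat := fun M k' hM hM₀ hk' => by
      haveI : NeZero M := ⟨hM₀⟩
      haveI : NeZero (k' * M) := ⟨mul_ne_zero hk' hM₀⟩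
      simp only [dif_neg hM₀, dif_neg (mul_ne_zero hk' hM₀)]
      rw [← RingHom.comp_apply, castHom_comp_integralAdeleResidue]
    κ_form := fun M hM hM₀ x y => by
      haveI : NeZero M := ⟨hM₀⟩
      simp only [dif_neg hM₀]
      have hE : Ez.map (integralAdeleResidue M) = typeFormOver δ (ZMod M) := typeFormOver_map δ _
      have hred : (Kz.map (integralAdeleResidue M))ᵀ * typeFormOver δ (ZMod M) * Kz.map (integralAdeleResidue M) =
          integralAdeleResidue M νz • typeFormOver δ (ZMod M) := by
        have := congrArg (fun B : Matrix (Fin g ⊕ Fin g) (Fin g ⊕ Fin g) (FiniteAdeleRing.integralAdeles (𝓞 ℚ) ℚ) =>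
          B.map (integralAdeleResidue M)) hKE
        simpa only [Matrix.map_mul, Matrix.transpose_map, hE, Matrix.map_smul' _ _ _ (map_mul _)] using this
      exact typeFormMod_mulVec_mulVec_of_transpose_mul_mul δ hred x y }

/-- The matrices of `reindexTowerOf`: at `M ≠ 0`, `κ_M` is `k mod M` entrywise. [cite: Deligne1971TravauxShimura, Exemple 4.16 p. 150] -/
theorem reindexTowerOf_κ_apply (hN : N ≠ 0) (hk : k ∈ principalLevelSubgroup δ N) {M : ℕ} [NeZero M]
    (i j : Fin g ⊕ Fin g) :
    (reindexTowerOf hN hk).κ M i j =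
      integralAdeleResidue M ⟨((k : GL (Fin g ⊕ Fin g) finAdeleQ) : Matrix (Fin g ⊕ Fin g) (Fin g ⊕ Fin g) finAdeleQ) i j,
        isIntegral_of_isCongOne_one (principalLevelSubgroup_anti δ (one_dvd N) hk).1 i j⟩ := by
  classical
  simp only [reindexTowerOf, dif_neg (NeZero.ne M)]
  rfl

/-! ### The adelic congruence under a right `K_δ(N)`-translate -/

/-- `K_δ(0) = {1}`: congruence modulo `0·ẑ = 0` forces `k = 1`. [cite: Deligne1971TravauxShimura, Exemple 4.16 p. 150] -/
theorem eq_one_of_mem_principalLevelSubgroup_zero (hk : k ∈ principalLevelSubgroup δ 0) : k = 1 := by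
  apply Subtype.ext
  apply Units.ext
  ext i j
  have h := hk.1 i j
  obtain ⟨y, -, hy⟩ := mem_levelIdeal_iff.1 h
  rw [Nat.cast_zero, zero_mul, eq_comm, Matrix.sub_apply, sub_eq_zero] at hy
  rw [hy, Subgroup.coe_one, Units.val_one]

/-- **The adelic congruence under a right `K_δ(N)`-translate**: if `(bk)⁻¹ v̂ ≡ x/M (mod ẑ^{2g})` for `k ∈ K_δ(N)`, `N ≠ 0`,
then `b⁻¹ v̂ ≡ (κ_M x)/M (mod ẑ^{2g})` with `κ_M = k mod M` the level-`M` matrix of ★ `reindexTowerOf`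
(`b⁻¹v̂ = k·((bk)⁻¹v̂) ≡ k·x/M`, and `k·x̃ ≡ κ_M x (mod M)` entrywise). [cite: Milne2005ShimuraVarieties, §6 Thm. 6.11 p. 74 and p. 75]
[cite: Deligne1971TravauxShimura, 4.16 p. 150] -/
theorem adelicCongr_inv_reindex_of_adelicCongr_mul_inv (hN : N ≠ 0) (hk : k ∈ principalLevelSubgroup δ N)
    {b : gspFinAdelic δ} {M : ℕ} (hM₀ : M ≠ 0) {x : Fin g ⊕ Fin g → ZMod M} {v : Fin g ⊕ Fin g → ℚ}
    (h : AdelicCongr (((b * k)⁻¹ : gspFinAdelic δ) : GL (Fin g ⊕ Fin g) finAdeleQ) 1 v (fun i => ((x i).val : ℚ) / M)) :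
    AdelicCongr ((b⁻¹ : gspFinAdelic δ) : GL (Fin g ⊕ Fin g) finAdeleQ) 1 v
      (fun i => ((((reindexTowerOf hN hk).κ M *ᵥ x) i).val : ℚ) / M) := by
  haveI : NeZero M := ⟨hM₀⟩
  have hk1 : k ∈ principalLevelSubgroup δ 1 := principalLevelSubgroup_anti δ (one_dvd N) hk
  -- step 1: multiply the hypothesis on the left by the integral matrix `k`: `b⁻¹ v̂ ≡ k · (x̃/M)`
  have h1 : AdelicCongr ((b⁻¹ : gspFinAdelic δ) : GL (Fin g ⊕ Fin g) finAdeleQ) (k : GL (Fin g ⊕ Fin g) finAdeleQ) v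
      (fun i => ((x i).val : ℚ) / M) := by
    have := AdelicCongr.mul_left (u := (k : GL (Fin g ⊕ Fin g) finAdeleQ)) (isIntegral_of_isCongOne_one hk1.1) h
    rwa [mul_one, Subgroup.coe_inv, Subgroup.coe_mul, _root_.mul_inv_rev, mul_inv_cancel_left, ← Subgroup.coe_inv] at this
  -- step 2: `k · (x̃/M) ≡ (κ_M x)~/M` — the adelic relabelling of ★ `SiegelPrincipalLevelSimilitudeTower`
  exact h1.trans (adelicCongr_val_div_of_entries_residue hk1 ((reindexTowerOf hN hk).κ M)
    (fun i j _ => reindexTowerOf_κ_apply hN hk i j) x)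

end Tower

end Literature.AlgebraicGeometry.ModuliOfAbelianVarieties

end

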